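import Mathlib
import Literature.Geometry.Symplectic.JHolomorphicMap
import Summits.SmoothPoincare4.SmoothPoincare4.Theorems.SullivanDualTameOrBrodyR4PencilDefs

/-!
# Uniqueness of members from local uniqueness (crux `TameOrBrodyR4`, stmt-SmoothPoincare4-7826, line `Sketch`, skeleton v17 — registered helper `helper_uniqueOfLocalUnique`)

Gromov's pencil of normalised `J`-holomorphic planes on `ℝ⁴` asymptotic to the flat planes
`{Q = b}` (vocabulary `Theorems/SullivanDualTameOrBrodyR4PencilDefs.lean`, `IsPencilMember`).
The deep input "two members with the same asymptotic value coincide" becomes SOFT bookkeeping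
once

* the local family through a member comes with LOCAL UNIQUENESS (hypothesis `hLFU`: the
  implicit-function-theorem package — every sequence of members whose values tend to `b₀` and
  which converges `C¹_loc` to the centre `u₀` of the family eventually lies in the family),
* far members are unique (hypothesis `hfarU`: for `R < |b|` two members with value `b` agree),
* sequences of members with convergent values `|b n| < 2R` have `C¹_loc`-convergent
  subsequences with a MEMBER as limit (hypothesis `hcomp`).

Proof (clopen argument).  Let `T` be the set of values `b` over which any two members agree.
`T` contains every far value, so it is nonempty.  `T` is closed: if `b n ∈ T`, `b n → bs` and
`u, u'` are members at `bs`, the local families `Φ, Φ'` through `u, u'` consist of members, so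
`Φ (b n) = Φ' (b n)` for `n` large (`b n ∈ T`), and letting `n → ∞` pointwise (continuity of
the families in the parameter) gives `u = Φ bs = Φ' bs = u'`.  `T` is open: near a far value
this is `hfarU`; at a value `b₀ ∈ T` with `|b₀| ≤ R`, if `T` were not a neighbourhood of `b₀`
there would be values `b n → b₀`, `|b n - b₀| < R / 2`, carrying two distinct members
`w n ≠ w' n`; by `hcomp` (twice) a common subsequence of `w` and `w'` converges `C¹_loc` to
members `v, v'` at `b₀`, equal since `b₀ ∈ T`; the uniqueness clause of the local family
through `v` then forces `w = Φ (b ·) = w'` eventually along the subsequence, a contradiction.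
Hence `T = ℂ` (`IsClopen.eq_univ`).

References: M. Gromov, *Pseudo holomorphic curves in symplectic manifolds*, Invent. Math. 82
(1985), §2.4.A; D. McDuff, D. Salamon, *J-holomorphic curves and symplectic topology*, 2nd ed.
(2012), Thm 3.1.5 and §3.3 (local families with uniqueness from the implicit function theorem).
-/

-- the registered namespace `Summit.SmoothPoincare4.SmoothPoincare4.…` repeats a component
set_option linter.dupNamespace false

noncomputable section

open scoped ContDiff Topology
open Filter Set Metric Literature.Geometry.Symplectic

namespace Summit.SmoothPoincare4.SmoothPoincare4.Cruxes.TameOrBrodyR4.Sketch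

/-- Local notation for the model space `ℝ⁴ = EuclideanSpace ℝ (Fin 4)`. -/
local notation "E4" => EuclideanSpace ℝ (Fin 4)

namespace UniqueOfLocalUnique

/-- Re-indexing a locally uniformly convergent family along a map tending to the index filter
(e.g. passing to a subsequence) preserves locally uniform convergence to the same limit. -/
theorem tendstoLocallyUniformly_comp_tendsto {ι κ α β : Type*} [TopologicalSpace α]
    [UniformSpace β] {F : ι → α → β} {f : α → β} {p : Filter ι} {q : Filter κ}
    (h : TendstoLocallyUniformly F f p) {θ : κ → ι} (hθ : Tendsto θ q p) :
    TendstoLocallyUniformly (fun k => F (θ k)) f q := by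
  intro u hu x
  obtain ⟨t, ht, H⟩ := h u hu x
  exact ⟨t, ht, hθ.eventually H⟩

/-- Continuity in the parameter of a jointly smooth family: if `(b, ξ) ↦ Φ b ξ` is `C^∞` on
`ball b₀ ε ×ˢ univ` (`ε > 0`) and `b n → b₀`, then `Φ (b n) ξ → Φ b₀ ξ` for every `ξ`. -/
theorem tendsto_param {Φ : ℂ → ℂ → E4} {b₀ : ℂ} {ε : ℝ} (hε : 0 < ε)
    (hΦ : ContDiffOn ℝ ∞ (fun p : ℂ × ℂ => Φ p.1 p.2) (ball b₀ ε ×ˢ univ))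
    {b : ℕ → ℂ} (hb : Tendsto b atTop (𝓝 b₀)) (ξ : ℂ) :
    Tendsto (fun n => Φ (b n) ξ) atTop (𝓝 (Φ b₀ ξ)) := by
  have hc : ContinuousOn (fun b' : ℂ => Φ b' ξ) (ball b₀ ε) := by
    have h2 : ContinuousOn (fun b' : ℂ => (b', ξ)) (ball b₀ ε) :=
      (continuous_id.prodMk continuous_const).continuousOn
    exact hΦ.continuousOn.comp h2 fun b' hb' => mk_mem_prod hb' (mem_univ _)
  exact (hc.continuousAt (ball_mem_nhds b₀ hε)).tendsto.comp hb

end UniqueOfLocalUnique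

/-- (TC) uniqueness of members from LOCAL uniqueness of the family, uniqueness over far values,
and compactness with convergence: the set of values with at most one member is clopen. -/
theorem helper_uniqueOfLocalUnique (J : E4 → E4 →L[ℝ] E4) (R : ℝ) (P Q : E4 →L[ℝ] ℂ)
    (hR : 0 < R)
    (hLFU : ∀ (b₀ : ℂ) (u₀ : ℂ → E4), IsPencilMember J R P Q b₀ u₀ →
      ∃ ε > 0, ∃ Φ : ℂ → ℂ → E4,
        ContDiffOn ℝ ∞ (fun p : ℂ × ℂ => Φ p.1 p.2) (Metric.ball b₀ ε ×ˢ univ) ∧ Φ b₀ = u₀ ∧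
        (∀ b ∈ Metric.ball b₀ ε, IsPencilMember J R P Q b (Φ b)) ∧
        (∀ b ∈ Metric.ball b₀ ε, ∀ ξ β ζ : ℂ,
          fderiv ℝ (fun b' => Φ b' ξ) b β = fderiv ℝ (Φ b) ξ ζ → β = 0) ∧
        (∀ (b' : ℕ → ℂ) (w : ℕ → ℂ → E4), (∀ n, IsPencilMember J R P Q (b' n) (w n)) →
          Tendsto b' atTop (𝓝 b₀) → TendstoLocallyUniformly w u₀ atTop →
          TendstoLocallyUniformly (fun n => fderiv ℝ (w n)) (fderiv ℝ u₀) atTop →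
          ∀ᶠ n in atTop, w n = Φ (b' n)))
    (hfarU : ∀ b : ℂ, R < ‖b‖ → ∀ u u' : ℂ → E4,
      IsPencilMember J R P Q b u → IsPencilMember J R P Q b u' → u = u')
    (hcomp : ∀ (b : ℕ → ℂ) (u : ℕ → ℂ → E4) (bs : ℂ),
      (∀ n, IsPencilMember J R P Q (b n) (u n)) → (∀ n, ‖b n‖ < 2 * R) →
      Tendsto b atTop (𝓝 bs) →
      ∃ (v : ℂ → E4) (φ : ℕ → ℕ), StrictMono φ ∧ IsPencilMember J R P Q bs v ∧
        TendstoLocallyUniformly (fun k => u (φ k)) v atTop ∧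
        TendstoLocallyUniformly (fun k => fderiv ℝ (u (φ k))) (fderiv ℝ v) atTop) :
    ∀ (b : ℂ) (u u' : ℂ → E4), IsPencilMember J R P Q b u → IsPencilMember J R P Q b u' →
      u = u' := by
  classical
  -- the set of good values: those over which any two members agree
  set T : Set ℂ := {b : ℂ | ∀ u u' : ℂ → E4, IsPencilMember J R P Q b u →
    IsPencilMember J R P Q b u' → u = u'} with hT
  have memT : ∀ {b : ℂ}, b ∈ T ↔ ∀ u u' : ℂ → E4, IsPencilMember J R P Q b u →
      IsPencilMember J R P Q b u' → u = u' := Iff.rfl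
  suffices hTu : T = univ by
    intro b u u' hu hu'
    have hb : b ∈ T := by rw [hTu]; exact mem_univ b
    exact (memT.mp hb) u u' hu hu'
  -- far values are good
  have hfar : ∀ b : ℂ, R < ‖b‖ → b ∈ T := fun b hb => memT.mpr (hfarU b hb)
  -- a far value, so `T` is nonempty
  have hne : ((2 * R : ℝ) : ℂ) ∈ T := by
    apply hfar
    rw [Complex.norm_of_nonneg (by positivity)]
    linarith
  -- `T` is closed
  have hclosed : IsClosed T := by
    refine IsSeqClosed.isClosed fun b bs hbT hbs => memT.mpr fun u u' hu hu' => ?_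
    obtain ⟨ε, hε, Φ, hΦs, hΦ0, hΦm, -, -⟩ := hLFU bs u hu
    obtain ⟨ε', hε', Φ', hΦs', hΦ0', hΦm', -, -⟩ := hLFU bs u' hu'
    have hev : ∀ᶠ n in atTop, Φ (b n) = Φ' (b n) := by
      filter_upwards [hbs.eventually_mem (ball_mem_nhds bs hε),
        hbs.eventually_mem (ball_mem_nhds bs hε')] with n hn hn'
      exact (memT.mp (hbT n)) (Φ (b n)) (Φ' (b n)) (hΦm _ hn) (hΦm' _ hn')
    funext ξ
    have t1 : Tendsto (fun n => Φ (b n) ξ) atTop (𝓝 (u ξ)) := by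
      rw [← hΦ0]
      exact UniqueOfLocalUnique.tendsto_param hε hΦs hbs ξ
    have t2 : Tendsto (fun n => Φ' (b n) ξ) atTop (𝓝 (u' ξ)) := by
      rw [← hΦ0']
      exact UniqueOfLocalUnique.tendsto_param hε' hΦs' hbs ξ
    exact tendsto_nhds_unique (t1.congr' (hev.mono fun n hn => congrFun hn ξ)) t2
  -- `T` is open
  have hopen : IsOpen T := by
    rw [isOpen_iff_mem_nhds]
    intro b₀ hb₀
    by_cases hfarb : R < ‖b₀‖
    · exact mem_of_superset ((isOpen_lt continuous_const continuous_norm).mem_nhds hfarb)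
        fun b hb => hfar b hb
    have hb₀R : ‖b₀‖ ≤ R := not_lt.mp hfarb
    by_contra hnot
    -- bad values accumulating at `b₀`
    have key : ∀ n : ℕ, ∃ b ∈ ball b₀ (min (1 / ((n : ℝ) + 1)) (R / 2)), b ∉ T := by
      intro n
      by_contra h
      have hB : ball b₀ (min (1 / ((n : ℝ) + 1)) (R / 2)) ∈ 𝓝 b₀ :=
        ball_mem_nhds b₀ (lt_min (by positivity) (by positivity))
      refine hnot (mem_of_superset hB fun b hb => ?_)
      by_contra hb'
      exact h ⟨b, hb, hb'⟩
    choose b hbB hbT using key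
    have hbs : Tendsto b atTop (𝓝 b₀) := by
      rw [tendsto_iff_dist_tendsto_zero]
      refine squeeze_zero (g := fun n : ℕ => 1 / ((n : ℝ) + 1)) (fun n => dist_nonneg)
        (fun n => ((lt_min_iff.mp (mem_ball.mp (hbB n))).1).le) ?_
      exact tendsto_one_div_add_atTop_nhds_zero_nat (𝕜 := ℝ)
    have hb2 : ∀ n, ‖b n‖ < 2 * R := by
      intro n
      have h1 : dist (b n) b₀ < R / 2 := (lt_min_iff.mp (mem_ball.mp (hbB n))).2
      rw [dist_eq_norm] at h1
      calc ‖b n‖ = ‖(b n - b₀) + b₀‖ := by rw [sub_add_cancel]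
        _ ≤ ‖b n - b₀‖ + ‖b₀‖ := norm_add_le _ _
        _ < 2 * R := by linarith
    -- two distinct members over each bad value
    have key2 : ∀ n, ∃ w w' : ℂ → E4, IsPencilMember J R P Q (b n) w ∧
        IsPencilMember J R P Q (b n) w' ∧ w ≠ w' := by
      intro n
      by_contra h
      refine hbT n (memT.mpr fun w w' hw hw' => ?_)
      by_contra hww
      exact h ⟨w, w', hw, hw', hww⟩
    choose w w' hw hw' hww using key2
    -- a common `C¹_loc`-convergent subsequence of `w` and `w'`
    obtain ⟨v, φ, hφ, hv, hloc, hlocd⟩ := hcomp b w b₀ hw hb2 hbs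
    obtain ⟨v', ψ, hψ, hv', hloc', hlocd'⟩ := hcomp (b ∘ φ) (fun k => w' (φ k)) b₀
      (fun k => hw' (φ k)) (fun k => hb2 (φ k)) (hbs.comp hφ.tendsto_atTop)
    have hvv' : v' = v := (memT.mp hb₀) v' v hv' hv
    rw [hvv'] at hloc' hlocd'
    -- the local family through `v` with its uniqueness clause
    obtain ⟨ε, -, Φ, -, -, -, -, hΦU⟩ := hLFU b₀ v hv
    have hθ : Tendsto (fun k => φ (ψ k)) atTop atTop := hφ.tendsto_atTop.comp hψ.tendsto_atTop
    have e1 : ∀ᶠ k in atTop, w (φ (ψ k)) = Φ (b (φ (ψ k))) :=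
      hΦU (fun k => b (φ (ψ k))) (fun k => w (φ (ψ k))) (fun k => hw _) (hbs.comp hθ)
        (UniqueOfLocalUnique.tendstoLocallyUniformly_comp_tendsto hloc hψ.tendsto_atTop)
        (UniqueOfLocalUnique.tendstoLocallyUniformly_comp_tendsto hlocd hψ.tendsto_atTop)
    have e2 : ∀ᶠ k in atTop, w' (φ (ψ k)) = Φ (b (φ (ψ k))) :=
      hΦU (fun k => b (φ (ψ k))) (fun k => w' (φ (ψ k))) (fun k => hw' _) (hbs.comp hθ)
        hloc' hlocd'
    obtain ⟨k, hk1, hk2⟩ := (e1.and e2).exists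
    exact hww (φ (ψ k)) (hk1.trans hk2.symm)
  exact IsClopen.eq_univ ⟨hclosed, hopen⟩ ⟨_, hne⟩

end Summit.SmoothPoincare4.SmoothPoincare4.Cruxes.TameOrBrodyR4.Sketch
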